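/-
Copyright: the b2b-balaban T⁴-continuum CRUX team, row NE7b OWNER lineage `t4-ne7b-p1` (gen 137). Project licence.
-/
import Summits.QuantumFields.BalabanUV.T4Continuum.Spine.NE7b.SupBlockNextHessianMatrix

/-!
# LOCALITY PASSES THROUGH THE STEP — A `Y`-LOCAL BLOCK INPUT HAS A `Y`-LOCAL OUTPUT, `b_D` LIVES ON `Y`, `K_D` ON `Y × Y`, AND THE LOWER
# LETTERS OF (409) TAKE THEIR `Σ_Y` FORM.  A block potential `U` is `Y`-LOCAL when `U φ = U φ′` whenever `φ = φ′` on `Y`.  Then, with NO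
# further hypothesis: the derivative annihilates directions supported off `Y` (`U′(φ)[v] = 0`), `U′` is itself `Y`-local, `U″(φ)[v,·] =
# U″(φ)[·,v] = 0`; the step integral `Z(ψ) = ∫e^{−U(ω+ψ)}dN(0,Γ)` and `W = −log Z` are `Y`-local, `DW(ψ)[v] = 0` off `Y`, the extracted vector
# `b_D(ψ₀)` VANISHES OFF `Y` and the extracted matrix `K_D(ψ₀)` VANISHES OFF `Y × Y` ((404)'s objects) — so the dressed step's data are as
# local as the input ((392)∕(395)'s support hypotheses DISCHARGED for block inputs) —, and (409)'s residual letters, typed with `Σ_i` over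
# all sites because (401)'s secant hypothesis is, REDUCE TO THEIR `Σ_Y` FORMS:
#   `|r(ζ)| ≤ (λ + ½Λ)·Σ_Yζ²`   for EVERY `ζ`   (`r(ζ) = log Z(ψ₀+ζ) − log Z(ψ₀) + ⟨b_D,ζ⟩ + ½ζᵀK_Dζ` depends on `ζ|_Y` only)
# — the OUTPUT single-block potential `w⁺ = −r` is `Y`-local with stability `−(λ+½Λ)Σ_Yζ² ≤ w⁺(ζ)` and upper growth `w⁺(ζ) ≤ (λ+½Λ)Σ_Yζ²`:
# the INPUT format's `hstab` ∕ `hUup` REGENERATED with `(κ₀⁺, κ_u⁺, a_u⁺) = (λ+½Λ, λ+½Λ, 0)` (row NE7b, node U5c; (399)∕(402)∕(404)∕(409) BY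
# NAME; [folklore])

Cell `pub-balaban`, sub-cell `t4`, spine estimate NE7b (`T4WeightBudget.RelWeightBound`; the cell's OWN estimate — NOT PRINTED in
[Bałaban 1983–89], NOT PROVED).  Crux-route work under `Spine/NE7b/` by the row OWNER (`t4-ne7b-p1` gen 137, file (412)) under FREEZE
(0)'s crux-prover clause, on gen 136's SCOPING-d8 (β1) («the class after a step is BLOCK-local»); NOTHING of Bałaban's is named as a Lean
object, valued or asserted; no `T4Continuum/Support` leaf typed; no `def`, no notation (`b_D`, `K_D`, the `Y`-projection WRITTEN OUT); zero
`sorry`.  Imports (BY NAME): the OWNER's (404) `…SupBlockNextHessianMatrix` (the objects) and through it (402)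
(`hasFDerivAt_fderiv_block_neg_log`), (399) (`hasFDerivAt_block_neg_log`); Mathlib's `HasFDerivAt.comp_hasDerivAt_of_eq`,
`HasDerivAt.unique`, `HasFDerivAt.unique`.

WHAT IS PROVED ([folklore]):
* §1 (pure calculus, any normed target) `fderiv_apply_eq_zero_of_local` (a `Y`-local differentiable map's derivative kills off-`Y` directions),
  `fderiv_local_of_local` (its derivative is `Y`-local), `fderiv_comp_apply_eq_zero` (if `φ ↦ f′(φ)[v] ≡ 0` then `f″(φ)[k][v] = 0`);
* §2 `blockDeriv_apply_eq_zero_off`, `blockDeriv_local`, `blockHess_apply_eq_zero_off` (both slots);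
* §3 `block_Z_local`, `block_W_local`, `block_fderiv_W_apply_eq_zero_off`, `block_fderiv_W_local`, **`blockGradient_eq_zero_off`** (`b_D(ψ₀)_x = 0`
  for `x ∉ Y`), **`blockHessianMatrix_eq_zero_off`** (`K_D(ψ₀)_{xy} = 0` unless `x ∈ Y ∧ y ∈ Y`);
  `block_hessianCLM_apply_off` ∕ `block_hessianCLM_apply_apply_off` (the Hessian CLM kills off-`Y` directions in either slot); §4 toy.
  The `Σ_Y` forms of (409)'s letters follow in the successor file (413).

HONEST (what this is NOT).  Bookkeeping of supports; the remaining INPUT letters of the output (`κ₁⁺` gradient, `κ₂⁺`, `κ₃⁺`, the secant form of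
the lower class letter) are the successor's; no contraction ((β4)), no decaying-covariance polymer expansion ((β3′)); scalar skeleton ((A3),
NC-NE7b-α UNRULED); nothing of Bałaban's asserted.  BY-NAME EFFECT ON THE WALL: NONE.  NE7b NOT PRINTED ∕ NOT PROVED; spine PROVED 0∕9; rung
(B)+1 — the programme's measures remain FINITE-torus statements; NOT the mass gap, NOT Clay.  HONEST DEPENDENCY: continuum YM on T⁴ ⇐ BetaPertH ∧
nine spine estimates (0∕9 proved); BetaPertH ⇐ (D1) ∧ (D4) ∧ CAP+tail; G-an2-4 gates asym, D1 and NE2∕3∕4.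
-/

set_option autoImplicit false
set_option maxSynthPendingDepth 2

noncomputable section

namespace Summit.QuantumFields.BalabanUV.T4Continuum.NE7b.SupBlockLocality

open MeasureTheory ProbabilityTheory Finset Real Matrix
open scoped BigOperators
open SupBlockEffectiveActionDerivative (hasFDerivAt_block_neg_log)
open SupBlockEffectiveActionHessian (hasFDerivAt_fderiv_block_neg_log)

variable {ι : Type} [Fintype ι] [DecidableEq ι]

/-! ## §1. Pure calculus: a `Y`-local differentiable map -/

section Calculus

variable {F : Type*} [NormedAddCommGroup F] [NormedSpace ℝ F] (Y : Finset ι)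

omit [DecidableEq ι] in
/-- **A `Y`-local differentiable map's derivative annihilates directions supported off `Y`.** [folklore] -/
theorem fderiv_apply_eq_zero_of_local {f : EuclideanSpace ℝ ι → F} {f' : EuclideanSpace ℝ ι → EuclideanSpace ℝ ι →L[ℝ] F}
    (hf : ∀ φ, HasFDerivAt f (f' φ) φ) (hloc : ∀ φ φ' : EuclideanSpace ℝ ι, (∀ x ∈ Y, φ x = φ' x) → f φ = f φ')
    (φ v : EuclideanSpace ℝ ι) (hv : ∀ x ∈ Y, v x = 0) : f' φ v = 0 := by
  have hline : HasDerivAt (fun t : ℝ => φ + t • v) ((1 : ℝ) • v) 0 := ((hasDerivAt_id (0 : ℝ)).smul_const v).const_add φ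
  have hcomp : HasDerivAt (fun t : ℝ => f (φ + t • v)) (f' φ ((1 : ℝ) • v)) 0 :=
    (hf φ).comp_hasDerivAt_of_eq (0 : ℝ) hline (by simp)
  have hconst : (fun t : ℝ => f (φ + t • v)) = fun _ => f φ := by
    funext t
    refine (hloc _ _ fun x hx => ?_).symm
    simp [hv x hx]
  rw [hconst, one_smul] at hcomp
  exact hcomp.unique (hasDerivAt_const (0 : ℝ) (f φ))

omit [DecidableEq ι] in
/-- **A `Y`-local differentiable map's derivative is `Y`-local.** [folklore] -/
theorem fderiv_local_of_local {f : EuclideanSpace ℝ ι → F} {f' : EuclideanSpace ℝ ι → EuclideanSpace ℝ ι →L[ℝ] F}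
    (hf : ∀ φ, HasFDerivAt f (f' φ) φ) (hloc : ∀ φ φ' : EuclideanSpace ℝ ι, (∀ x ∈ Y, φ x = φ' x) → f φ = f φ')
    (φ φ' : EuclideanSpace ℝ ι) (h : ∀ x ∈ Y, φ x = φ' x) : f' φ = f' φ' := by
  have htr : HasFDerivAt (fun ψ : EuclideanSpace ℝ ι => ψ + (φ' - φ)) (ContinuousLinearMap.id ℝ (EuclideanSpace ℝ ι)) φ :=
    (hasFDerivAt_id φ).add_const (φ' - φ)
  have hc := (hf (φ + (φ' - φ))).comp φ htr
  rw [ContinuousLinearMap.comp_id, add_sub_cancel] at hc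
  have hfun : (f ∘ fun ψ : EuclideanSpace ℝ ι => ψ + (φ' - φ)) = f := by
    funext ψ
    refine hloc _ _ fun x hx => ?_
    simp [h x hx]
  rw [hfun] at hc
  exact (hf φ).unique hc

omit [DecidableEq ι] in
/-- **If `φ ↦ f′(φ)[v]` vanishes identically then `f″(φ)[k][v] = 0` for every `k`** (`f′` differentiable with derivative `f″`). [folklore] -/
theorem fderiv_comp_apply_eq_zero {f' : EuclideanSpace ℝ ι → EuclideanSpace ℝ ι →L[ℝ] F}
    {f'' : EuclideanSpace ℝ ι → EuclideanSpace ℝ ι →L[ℝ] EuclideanSpace ℝ ι →L[ℝ] F} (hf' : ∀ φ, HasFDerivAt f' (f'' φ) φ)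
    (v : EuclideanSpace ℝ ι) (hzero : ∀ φ, f' φ v = 0) (φ k : EuclideanSpace ℝ ι) : f'' φ k v = 0 := by
  have h1 := ((ContinuousLinearMap.apply ℝ F v).hasFDerivAt).comp φ (hf' φ)
  have hfun : (⇑(ContinuousLinearMap.apply ℝ F v) ∘ f') = fun _ => (0 : F) := by
    funext ψ
    simp [hzero ψ]
  rw [hfun] at h1
  have h2 := (hasFDerivAt_const (0 : F) φ).unique h1
  have h3 := congrArg (fun L : EuclideanSpace ℝ ι →L[ℝ] F => L k) h2
  simpa using h3.symm

end Calculus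

/-! ## §2. The block potential: `U′` kills off-`Y` directions, `U′` is local, `U″` kills off-`Y` directions in both slots -/

section Potential

variable (Y : Finset ι) {U : EuclideanSpace ℝ ι → ℝ} {U' : EuclideanSpace ℝ ι → EuclideanSpace ℝ ι →L[ℝ] ℝ}
  {U'' : EuclideanSpace ℝ ι → EuclideanSpace ℝ ι →L[ℝ] EuclideanSpace ℝ ι →L[ℝ] ℝ}

omit [DecidableEq ι] in
/-- `U′(φ)[v] = 0` for `v` supported off `Y`. [folklore] -/
theorem blockDeriv_apply_eq_zero_off (hUd : ∀ φ : EuclideanSpace ℝ ι, HasFDerivAt U (U' φ) φ)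
    (hUloc : ∀ φ φ' : EuclideanSpace ℝ ι, (∀ x ∈ Y, φ x = φ' x) → U φ = U φ') (φ v : EuclideanSpace ℝ ι) (hv : ∀ x ∈ Y, v x = 0) :
    U' φ v = 0 :=
  fderiv_apply_eq_zero_of_local Y hUd hUloc φ v hv

omit [DecidableEq ι] in
/-- `U′` is `Y`-local. [folklore] -/
theorem blockDeriv_local (hUd : ∀ φ : EuclideanSpace ℝ ι, HasFDerivAt U (U' φ) φ)
    (hUloc : ∀ φ φ' : EuclideanSpace ℝ ι, (∀ x ∈ Y, φ x = φ' x) → U φ = U φ') (φ φ' : EuclideanSpace ℝ ι) (h : ∀ x ∈ Y, φ x = φ' x) :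
    U' φ = U' φ' :=
  fderiv_local_of_local Y hUd hUloc φ φ' h

omit [DecidableEq ι] in
/-- `U″(φ)[v][k] = 0` and `U″(φ)[k][v] = 0` for `v` supported off `Y`. [folklore] -/
theorem blockHess_apply_eq_zero_off (hUd : ∀ φ : EuclideanSpace ℝ ι, HasFDerivAt U (U' φ) φ) (hU'd : ∀ φ : EuclideanSpace ℝ ι, HasFDerivAt U' (U'' φ) φ)
    (hUloc : ∀ φ φ' : EuclideanSpace ℝ ι, (∀ x ∈ Y, φ x = φ' x) → U φ = U φ') (φ v k : EuclideanSpace ℝ ι) (hv : ∀ x ∈ Y, v x = 0) :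
    U'' φ v k = 0 ∧ U'' φ k v = 0 := by
  refine ⟨?_, fderiv_comp_apply_eq_zero hU'd v (fun ψ => blockDeriv_apply_eq_zero_off Y hUd hUloc ψ v hv) φ k⟩
  have h := fderiv_apply_eq_zero_of_local Y hU'd (fun ψ ψ' hψ => blockDeriv_local Y hUd hUloc ψ ψ' hψ) φ v hv
  rw [h, _root_.zero_apply]

end Potential

/-! ## §3. The step: `Z`, `W`, `DW`, `b_D`, `K_D` are local -/

section Step

variable {Γ : Matrix ι ι ℝ} {γop : ℝ} {U : EuclideanSpace ℝ ι → ℝ} {U' : EuclideanSpace ℝ ι → EuclideanSpace ℝ ι →L[ℝ] ℝ}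
  {U'' : EuclideanSpace ℝ ι → EuclideanSpace ℝ ι →L[ℝ] EuclideanSpace ℝ ι →L[ℝ] ℝ} {κ₀ κ₁ κ₂ a τ δ θ : ℝ}

/-- **`Z` is `Y`-local**: `Z(ψ) = Z(ψ′)` if `ψ = ψ′` on `Y`. [folklore] -/
theorem block_Z_local (Γ : Matrix ι ι ℝ) (Y : Finset ι) (hUloc : ∀ φ φ' : EuclideanSpace ℝ ι, (∀ x ∈ Y, φ x = φ' x) → U φ = U φ')
    (ψ ψ' : EuclideanSpace ℝ ι) (h : ∀ x ∈ Y, ψ x = ψ' x) :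
    (∫ ω : EuclideanSpace ℝ ι, exp (-U (ω + ψ)) ∂(multivariateGaussian 0 Γ)) = (∫ ω : EuclideanSpace ℝ ι, exp (-U (ω + ψ')) ∂(multivariateGaussian 0 Γ)) := by
  refine integral_congr_ae (ae_of_all _ fun ω => ?_)
  dsimp only
  rw [hUloc (ω + ψ) (ω + ψ') fun x hx => by simp [h x hx]]

/-- **`W = −log Z` is `Y`-local.** [folklore] -/
theorem block_W_local (Γ : Matrix ι ι ℝ) (Y : Finset ι) (hUloc : ∀ φ φ' : EuclideanSpace ℝ ι, (∀ x ∈ Y, φ x = φ' x) → U φ = U φ')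
    (ψ ψ' : EuclideanSpace ℝ ι) (h : ∀ x ∈ Y, ψ x = ψ' x) :
    (fun φ : EuclideanSpace ℝ ι => -Real.log (∫ ω : EuclideanSpace ℝ ι, exp (-U (ω + φ)) ∂(multivariateGaussian 0 Γ))) ψ = (fun φ : EuclideanSpace ℝ ι => -Real.log (∫ ω :
        EuclideanSpace ℝ ι, exp (-U (ω + φ)) ∂(multivariateGaussian 0 Γ))) ψ' := by
  dsimp only
  rw [block_Z_local Γ Y hUloc ψ ψ' h]

/-- **`DW(ψ₀)[v] = 0` for `v` supported off `Y`** ((399)'s derivative + §1). [folklore] -/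
theorem block_fderiv_W_apply_eq_zero_off (hΓ : Γ.PosSemidef) (hΓop : (γop • (1 : Matrix ι ι ℝ) - Γ).PosSemidef) (Y : Finset ι)
    (hUd : ∀ φ : EuclideanSpace ℝ ι, HasFDerivAt U (U' φ) φ) (hU'c : Continuous U')
    (hκ₀ : 0 ≤ κ₀) (hκ₁ : 0 ≤ κ₁) (ha : 0 ≤ a) (hτ : 0 < τ) (hδ : 0 < δ) (hθ0 : 0 < θ) (hθ1 : θ < 1)
    (hκθ : (2 * κ₀ * (1 + τ) + 4 * δ) * γop ≤ θ) (hstab : ∀ φ : EuclideanSpace ℝ ι, -(κ₀ * ∑ x ∈ Y, φ x ^ 2) ≤ U φ)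
    (hU'b : ∀ φ : EuclideanSpace ℝ ι, ‖U' φ‖ ≤ κ₁ * (a + ∑ x ∈ Y, φ x ^ 2)) (hUloc : ∀ φ φ' : EuclideanSpace ℝ ι, (∀ x ∈ Y, φ x = φ' x) → U φ = U φ') (ψ₀ v : EuclideanSpace
        ℝ ι) (hv : ∀ x ∈ Y, v x = 0) :
    ((∫ ω : EuclideanSpace ℝ ι, exp (-U (ω + ψ₀)) ∂(multivariateGaussian 0 Γ))⁻¹ • ∫ ω : EuclideanSpace ℝ ι, exp (-U (ω + ψ₀)) • U' (ω + ψ₀) ∂(multivariateGaussian 0 Γ)) v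
        = 0 :=
  fderiv_apply_eq_zero_of_local Y (fun ψ => hasFDerivAt_block_neg_log hΓ hΓop Y hUd hU'c hκ₀ hκ₁ ha hτ hδ hθ0 hθ1 hκθ hstab hU'b ψ) (block_W_local Γ Y hUloc) ψ₀ v hv

/-- **`DW` is `Y`-local** (as the map `ψ ↦ fderiv ℝ W ψ`). [folklore] -/
theorem block_fderiv_W_local (hΓ : Γ.PosSemidef) (hΓop : (γop • (1 : Matrix ι ι ℝ) - Γ).PosSemidef) (Y : Finset ι)
    (hUd : ∀ φ : EuclideanSpace ℝ ι, HasFDerivAt U (U' φ) φ) (hU'c : Continuous U')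
    (hκ₀ : 0 ≤ κ₀) (hκ₁ : 0 ≤ κ₁) (ha : 0 ≤ a) (hτ : 0 < τ) (hδ : 0 < δ) (hθ0 : 0 < θ) (hθ1 : θ < 1)
    (hκθ : (2 * κ₀ * (1 + τ) + 4 * δ) * γop ≤ θ) (hstab : ∀ φ : EuclideanSpace ℝ ι, -(κ₀ * ∑ x ∈ Y, φ x ^ 2) ≤ U φ)
    (hU'b : ∀ φ : EuclideanSpace ℝ ι, ‖U' φ‖ ≤ κ₁ * (a + ∑ x ∈ Y, φ x ^ 2)) (hUloc : ∀ φ φ' : EuclideanSpace ℝ ι, (∀ x ∈ Y, φ x = φ' x) → U φ = U φ') (ψ ψ' : EuclideanSpace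
        ℝ ι) (h : ∀ x ∈ Y, ψ x = ψ' x) :
    fderiv ℝ (fun φ : EuclideanSpace ℝ ι => -Real.log (∫ ω : EuclideanSpace ℝ ι, exp (-U (ω + φ)) ∂(multivariateGaussian 0 Γ))) ψ = fderiv ℝ (fun φ : EuclideanSpace ℝ ι =>
        -Real.log (∫ ω : EuclideanSpace ℝ ι, exp (-U (ω + φ)) ∂(multivariateGaussian 0 Γ))) ψ' := by
  rw [(hasFDerivAt_block_neg_log hΓ hΓop Y hUd hU'c hκ₀ hκ₁ ha hτ hδ hθ0 hθ1 hκθ hstab hU'b ψ).fderiv, (hasFDerivAt_block_neg_log hΓ hΓop Y hUd hU'c hκ₀ hκ₁ ha hτ hδ hθ0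
      hθ1 hκθ hstab hU'b ψ').fderiv]
  exact fderiv_local_of_local Y (fun ψ => hasFDerivAt_block_neg_log hΓ hΓop Y hUd hU'c hκ₀ hκ₁ ha hτ hδ hθ0 hθ1 hκθ hstab hU'b ψ) (block_W_local Γ Y hUloc) ψ ψ' h

/-- **THE EXTRACTED VECTOR LIVES ON `Y`**: `b_D(ψ₀)_x = 0` for `x ∉ Y` — (392)'s support hypothesis `hoff` DISCHARGED for block inputs. [folklore] -/
theorem blockGradient_eq_zero_off (hΓ : Γ.PosSemidef) (hΓop : (γop • (1 : Matrix ι ι ℝ) - Γ).PosSemidef) (Y : Finset ι)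
    (hUd : ∀ φ : EuclideanSpace ℝ ι, HasFDerivAt U (U' φ) φ) (hU'c : Continuous U')
    (hκ₀ : 0 ≤ κ₀) (hκ₁ : 0 ≤ κ₁) (ha : 0 ≤ a) (hτ : 0 < τ) (hδ : 0 < δ) (hθ0 : 0 < θ) (hθ1 : θ < 1)
    (hκθ : (2 * κ₀ * (1 + τ) + 4 * δ) * γop ≤ θ) (hstab : ∀ φ : EuclideanSpace ℝ ι, -(κ₀ * ∑ x ∈ Y, φ x ^ 2) ≤ U φ)
    (hU'b : ∀ φ : EuclideanSpace ℝ ι, ‖U' φ‖ ≤ κ₁ * (a + ∑ x ∈ Y, φ x ^ 2)) (hUloc : ∀ φ φ' : EuclideanSpace ℝ ι, (∀ x ∈ Y, φ x = φ' x) → U φ = U φ') (ψ₀ : EuclideanSpace ℝ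
        ι) (x : ι) (hx : x ∉ Y) :
    (fun x : ι => ((∫ ω : EuclideanSpace ℝ ι, exp (-U (ω + ψ₀)) ∂(multivariateGaussian 0 Γ))⁻¹ • ∫ ω : EuclideanSpace ℝ ι, exp (-U (ω + ψ₀)) • U' (ω + ψ₀)
        ∂(multivariateGaussian 0 Γ)) (EuclideanSpace.single x (1 : ℝ))) x = 0 := by
  dsimp only
  exact block_fderiv_W_apply_eq_zero_off hΓ hΓop Y hUd hU'c hκ₀ hκ₁ ha hτ hδ hθ0 hθ1 hκθ hstab hU'b hUloc ψ₀ _ fun y hy => by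
    have hyx : y ≠ x := fun e => hx (e ▸ hy)
    simp [hyx]

/-- **The Hessian CLM of `W` kills off-`Y` directions in its FIRST slot**: `HessW(ψ₀)[v] = 0` for `v` supported off `Y` ((402) + §1 on the
local map `ψ ↦ DW(ψ)`). [folklore] -/
theorem block_hessianCLM_apply_off (hΓ : Γ.PosSemidef) (hΓop : (γop • (1 : Matrix ι ι ℝ) - Γ).PosSemidef) (Y : Finset ι)
    (hUd : ∀ φ : EuclideanSpace ℝ ι, HasFDerivAt U (U' φ) φ) (hU'd : ∀ φ : EuclideanSpace ℝ ι, HasFDerivAt U' (U'' φ) φ)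
    (hU''c : Continuous U'') (hκ₀ : 0 ≤ κ₀) (hκ₁ : 0 ≤ κ₁) (ha : 0 ≤ a) (hκ₂ : 0 ≤ κ₂) (hτ : 0 < τ) (hδ : 0 < δ) (hθ0 : 0 < θ) (hθ1 : θ < 1)
    (hκθ : (2 * κ₀ * (1 + τ) + 4 * δ) * γop ≤ θ) (hstab : ∀ φ : EuclideanSpace ℝ ι, -(κ₀ * ∑ x ∈ Y, φ x ^ 2) ≤ U φ)
    (hU'b : ∀ φ : EuclideanSpace ℝ ι, ‖U' φ‖ ≤ κ₁ * (a + ∑ x ∈ Y, φ x ^ 2)) (hU''b : ∀ φ : EuclideanSpace ℝ ι, ‖U'' φ‖ ≤ κ₂)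
    (hUloc : ∀ φ φ' : EuclideanSpace ℝ ι, (∀ x ∈ Y, φ x = φ' x) → U φ = U φ') (ψ₀ v : EuclideanSpace ℝ ι) (hv : ∀ x ∈ Y, v x = 0) :
    ((∫ ω : EuclideanSpace ℝ ι, exp (-U (ω + ψ₀)) ∂(multivariateGaussian 0 Γ))⁻¹ • (∫ ω : EuclideanSpace ℝ ι, exp (-U (ω + ψ₀)) • (U'' (ω + ψ₀) - (U' (ω + ψ₀)).smulRight
        (U' (ω + ψ₀))) ∂(multivariateGaussian 0 Γ)) + (((∫ ω : EuclideanSpace ℝ ι, exp (-U (ω + ψ₀)) ∂(multivariateGaussian 0 Γ)) ^ 2)⁻¹ • ∫ ω : EuclideanSpace ℝ ι, exp (-U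
        (ω + ψ₀)) • U' (ω + ψ₀) ∂(multivariateGaussian 0 Γ)).smulRight (∫ ω : EuclideanSpace ℝ ι, exp (-U (ω + ψ₀)) • U' (ω + ψ₀) ∂(multivariateGaussian 0 Γ))) v = 0 := by
  have hU'c : Continuous U' := continuous_iff_continuousAt.2 fun φ => (hU'd φ).continuousAt
  exact fderiv_apply_eq_zero_of_local Y (fun ψ => hasFDerivAt_fderiv_block_neg_log hΓ hΓop Y hUd hU'd hU''c hκ₀ hκ₁ ha hκ₂ hτ hδ hθ0 hθ1 hκθ hstab hU'b hU''b ψ)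
    (block_fderiv_W_local hΓ hΓop Y hUd hU'c hκ₀ hκ₁ ha hτ hδ hθ0 hθ1 hκθ hstab hU'b hUloc) ψ₀ v hv

/-- **The Hessian CLM of `W` kills off-`Y` directions in its SECOND slot**: `HessW(ψ₀)[k][v] = 0` for every `k` and `v` supported off `Y`
(`ψ ↦ DW(ψ)[v] ≡ 0` + §1). [folklore] -/
theorem block_hessianCLM_apply_apply_off (hΓ : Γ.PosSemidef) (hΓop : (γop • (1 : Matrix ι ι ℝ) - Γ).PosSemidef) (Y : Finset ι)
    (hUd : ∀ φ : EuclideanSpace ℝ ι, HasFDerivAt U (U' φ) φ) (hU'd : ∀ φ : EuclideanSpace ℝ ι, HasFDerivAt U' (U'' φ) φ)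
    (hU''c : Continuous U'') (hκ₀ : 0 ≤ κ₀) (hκ₁ : 0 ≤ κ₁) (ha : 0 ≤ a) (hκ₂ : 0 ≤ κ₂) (hτ : 0 < τ) (hδ : 0 < δ) (hθ0 : 0 < θ) (hθ1 : θ < 1)
    (hκθ : (2 * κ₀ * (1 + τ) + 4 * δ) * γop ≤ θ) (hstab : ∀ φ : EuclideanSpace ℝ ι, -(κ₀ * ∑ x ∈ Y, φ x ^ 2) ≤ U φ)
    (hU'b : ∀ φ : EuclideanSpace ℝ ι, ‖U' φ‖ ≤ κ₁ * (a + ∑ x ∈ Y, φ x ^ 2)) (hU''b : ∀ φ : EuclideanSpace ℝ ι, ‖U'' φ‖ ≤ κ₂)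
    (hUloc : ∀ φ φ' : EuclideanSpace ℝ ι, (∀ x ∈ Y, φ x = φ' x) → U φ = U φ') (ψ₀ k v : EuclideanSpace ℝ ι) (hv : ∀ x ∈ Y, v x = 0) :
    ((∫ ω : EuclideanSpace ℝ ι, exp (-U (ω + ψ₀)) ∂(multivariateGaussian 0 Γ))⁻¹ • (∫ ω : EuclideanSpace ℝ ι, exp (-U (ω + ψ₀)) • (U'' (ω + ψ₀) - (U' (ω + ψ₀)).smulRight
        (U' (ω + ψ₀))) ∂(multivariateGaussian 0 Γ)) + (((∫ ω : EuclideanSpace ℝ ι, exp (-U (ω + ψ₀)) ∂(multivariateGaussian 0 Γ)) ^ 2)⁻¹ • ∫ ω : EuclideanSpace ℝ ι, exp (-U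
        (ω + ψ₀)) • U' (ω + ψ₀) ∂(multivariateGaussian 0 Γ)).smulRight (∫ ω : EuclideanSpace ℝ ι, exp (-U (ω + ψ₀)) • U' (ω + ψ₀) ∂(multivariateGaussian 0 Γ))) k v = 0 :=
        by
  have hU'c : Continuous U' := continuous_iff_continuousAt.2 fun φ => (hU'd φ).continuousAt
  exact fderiv_comp_apply_eq_zero (fun ψ => hasFDerivAt_fderiv_block_neg_log hΓ hΓop Y hUd hU'd hU''c hκ₀ hκ₁ ha hκ₂ hτ hδ hθ0 hθ1 hκθ hstab hU'b hU''b ψ) v (fun ψ => by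
    rw [(hasFDerivAt_block_neg_log hΓ hΓop Y hUd hU'c hκ₀ hκ₁ ha hτ hδ hθ0 hθ1 hκθ hstab hU'b ψ).fderiv]
    exact block_fderiv_W_apply_eq_zero_off hΓ hΓop Y hUd hU'c hκ₀ hκ₁ ha hτ hδ hθ0 hθ1 hκθ hstab hU'b hUloc ψ v hv) ψ₀ k

/-- **THE EXTRACTED MATRIX LIVES ON `Y × Y`**: `K_D(ψ₀)_{xy} = 0` unless `x ∈ Y` and `y ∈ Y` — (395)'s support hypothesis DISCHARGED for
block inputs (so `K_D` has the finite range of `Y` and (393)'s decay letters apply). [folklore] -/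
theorem blockHessianMatrix_eq_zero_off (hΓ : Γ.PosSemidef) (hΓop : (γop • (1 : Matrix ι ι ℝ) - Γ).PosSemidef) (Y : Finset ι)
    (hUd : ∀ φ : EuclideanSpace ℝ ι, HasFDerivAt U (U' φ) φ) (hU'd : ∀ φ : EuclideanSpace ℝ ι, HasFDerivAt U' (U'' φ) φ)
    (hU''c : Continuous U'') (hκ₀ : 0 ≤ κ₀) (hκ₁ : 0 ≤ κ₁) (ha : 0 ≤ a) (hκ₂ : 0 ≤ κ₂) (hτ : 0 < τ) (hδ : 0 < δ) (hθ0 : 0 < θ) (hθ1 : θ < 1)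
    (hκθ : (2 * κ₀ * (1 + τ) + 4 * δ) * γop ≤ θ) (hstab : ∀ φ : EuclideanSpace ℝ ι, -(κ₀ * ∑ x ∈ Y, φ x ^ 2) ≤ U φ)
    (hU'b : ∀ φ : EuclideanSpace ℝ ι, ‖U' φ‖ ≤ κ₁ * (a + ∑ x ∈ Y, φ x ^ 2)) (hU''b : ∀ φ : EuclideanSpace ℝ ι, ‖U'' φ‖ ≤ κ₂)
    (hUloc : ∀ φ φ' : EuclideanSpace ℝ ι, (∀ x ∈ Y, φ x = φ' x) → U φ = U φ') (ψ₀ : EuclideanSpace ℝ ι) (x y : ι) (hxy : ¬(x ∈ Y ∧ y ∈ Y)) :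
    (Matrix.of fun x y : ι => (((∫ ω : EuclideanSpace ℝ ι, exp (-U (ω + ψ₀)) ∂(multivariateGaussian 0 Γ))⁻¹ • (∫ ω : EuclideanSpace ℝ ι, exp (-U (ω + ψ₀)) • (U'' (ω + ψ₀) -
        (U' (ω + ψ₀)).smulRight (U' (ω + ψ₀))) ∂(multivariateGaussian 0 Γ)) + (((∫ ω : EuclideanSpace ℝ ι, exp (-U (ω + ψ₀)) ∂(multivariateGaussian 0 Γ)) ^ 2)⁻¹ • ∫ ω :
        EuclideanSpace ℝ ι, exp (-U (ω + ψ₀)) • U' (ω + ψ₀) ∂(multivariateGaussian 0 Γ)).smulRight (∫ ω : EuclideanSpace ℝ ι, exp (-U (ω + ψ₀)) • U' (ω + ψ₀)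
        ∂(multivariateGaussian 0 Γ))) (EuclideanSpace.single x (1 : ℝ)) (EuclideanSpace.single y (1 : ℝ)) + ((∫ ω : EuclideanSpace ℝ ι, exp (-U (ω + ψ₀))
        ∂(multivariateGaussian 0 Γ))⁻¹ • (∫ ω : EuclideanSpace ℝ ι, exp (-U (ω + ψ₀)) • (U'' (ω + ψ₀) - (U' (ω + ψ₀)).smulRight (U' (ω + ψ₀))) ∂(multivariateGaussian 0 Γ))
        + (((∫ ω : EuclideanSpace ℝ ι, exp (-U (ω + ψ₀)) ∂(multivariateGaussian 0 Γ)) ^ 2)⁻¹ • ∫ ω : EuclideanSpace ℝ ι, exp (-U (ω + ψ₀)) • U' (ω + ψ₀)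
        ∂(multivariateGaussian 0 Γ)).smulRight (∫ ω : EuclideanSpace ℝ ι, exp (-U (ω + ψ₀)) • U' (ω + ψ₀) ∂(multivariateGaussian 0 Γ))) (EuclideanSpace.single y (1 : ℝ))
        (EuclideanSpace.single x (1 : ℝ))) / 2) x y = 0 := by
  have hoff : ∀ z : ι, z ∉ Y → ∀ u ∈ Y, (EuclideanSpace.single z (1 : ℝ) : EuclideanSpace ℝ ι) u = 0 := fun z hz u hu => by
    have huz : u ≠ z := fun e => hz (e ▸ hu)
    simp [huz]
  have hfirst : ∀ z : ι, z ∉ Y → ∀ k : EuclideanSpace ℝ ι, ((∫ ω : EuclideanSpace ℝ ι, exp (-U (ω + ψ₀)) ∂(multivariateGaussian 0 Γ))⁻¹ • (∫ ω : EuclideanSpace ℝ ι, exp (-U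
      (ω + ψ₀)) • (U'' (ω + ψ₀) - (U' (ω + ψ₀)).smulRight (U' (ω + ψ₀))) ∂(multivariateGaussian 0 Γ)) + (((∫ ω : EuclideanSpace ℝ ι, exp (-U (ω + ψ₀))
      ∂(multivariateGaussian 0 Γ)) ^ 2)⁻¹ • ∫ ω : EuclideanSpace ℝ ι, exp (-U (ω + ψ₀)) • U' (ω + ψ₀) ∂(multivariateGaussian 0 Γ)).smulRight (∫ ω : EuclideanSpace ℝ ι, exp
      (-U (ω + ψ₀)) • U' (ω + ψ₀) ∂(multivariateGaussian 0 Γ))) (EuclideanSpace.single z (1 : ℝ)) k = 0 := fun z hz k => by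
    rw [block_hessianCLM_apply_off hΓ hΓop Y hUd hU'd hU''c hκ₀ hκ₁ ha hκ₂ hτ hδ hθ0 hθ1 hκθ hstab hU'b hU''b hUloc ψ₀ _ (hoff z hz), _root_.zero_apply]
  have hsecond : ∀ z : ι, z ∉ Y → ∀ k : EuclideanSpace ℝ ι, ((∫ ω : EuclideanSpace ℝ ι, exp (-U (ω + ψ₀)) ∂(multivariateGaussian 0 Γ))⁻¹ • (∫ ω : EuclideanSpace ℝ ι, exp
      (-U (ω + ψ₀)) • (U'' (ω + ψ₀) - (U' (ω + ψ₀)).smulRight (U' (ω + ψ₀))) ∂(multivariateGaussian 0 Γ)) + (((∫ ω : EuclideanSpace ℝ ι, exp (-U (ω + ψ₀))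
      ∂(multivariateGaussian 0 Γ)) ^ 2)⁻¹ • ∫ ω : EuclideanSpace ℝ ι, exp (-U (ω + ψ₀)) • U' (ω + ψ₀) ∂(multivariateGaussian 0 Γ)).smulRight (∫ ω : EuclideanSpace ℝ ι, exp
      (-U (ω + ψ₀)) • U' (ω + ψ₀) ∂(multivariateGaussian 0 Γ))) k (EuclideanSpace.single z (1 : ℝ)) = 0 := fun z hz k =>
    block_hessianCLM_apply_apply_off hΓ hΓop Y hUd hU'd hU''c hκ₀ hκ₁ ha hκ₂ hτ hδ hθ0 hθ1 hκθ hstab hU'b hU''b hUloc ψ₀ k _ (hoff z hz)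
  rw [Matrix.of_apply]
  rcases not_and_or.1 hxy with hx | hy
  · rw [hfirst x hx, hsecond x hx, add_zero, zero_div]
  · rw [hsecond y hy, hfirst y hy, add_zero, zero_div]

end Step

/-! ## §4. Toy -/

/-- Toy (§1): a constant map is `Y`-local and its (zero) derivative kills every direction. -/
example (Y : Finset ι) (c : ℝ) (φ v : EuclideanSpace ℝ ι) (hv : ∀ x ∈ Y, v x = 0) :
    (fun _ : EuclideanSpace ℝ ι => (0 : EuclideanSpace ℝ ι →L[ℝ] ℝ)) φ v = 0 :=
  fderiv_apply_eq_zero_of_local Y (f := fun _ => c) (fun φ => hasFDerivAt_const c φ) (fun _ _ _ => rfl) φ v hv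

end Summit.QuantumFields.BalabanUV.T4Continuum.NE7b.SupBlockLocality
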